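import Summits.MatrixMultiplication.MatrixMultiplication.Theorems.AbelianSTPPCensusTAStatKMemberSound

/-!
# Static t*-certificate: the k-member bucket-descent tree with SEVERAL Grynkiewicz parameters per node (data-free definitions)

Cell mm-stpp (rung F-M1).  The k-member tree of `AbelianSTPPCensusTAStatKMember.lean` (vp-p2 gen 5) tests a node's U11-G branch at ONE budget parameter,
the bucket's lower end `t = TB[j]`.  Rule U11-G holds at EVERY parameter `t ≥ 3` that has a source member (smallest size `< t ≤` its least pair product), and
the explicit members of a node often die only at a parameter well below `TB[j]` (T_C: the cell `(12,12,13)` + seven near-cubes at the orders `3127 …` passes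
at `t = 139` and fails at `t ≈ 88`).  This file adds to the node test a list of EXTRA parameters `x = (t′, gW′, wW′)` per bucket (`xrow j`; `gW′/wW′` = the
U11-G density of the non-explicit members at `t′`), each tried with an EXPLICIT source only — an explicit companion (`amin < t′ ≤ TB[j]`, every explicit
companion having `t ≥ TB[j]`) or the maximal member `l` itself (`al < t′ ≤ tl`) —: `testX` / `testKX`; the tree `treeKX` / `rootKX` / `coverKX` and the bucket
walk `walk4` are `treeK` / `rootK` / `coverK` / `walk3` with the node test `testKX` (case (i) `goI` is reused by name).  `testX_sound` is the arithmetic meaning of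
the extra test; the tree's soundness is in `AbelianSTPPCensusTAStatKMemberXSound.lean`.  Exact integer twin: seat calc/twomember/tastat8.py (vp-p2 g6).
WHAT THIS IS NOT: no statement about STPP families, orders or `ω` — Bool checks on shape data and their arithmetic meaning; nothing here is specific to a range or a `τ`.
-/

set_option linter.dupNamespace false
set_option autoImplicit false

namespace Summit.MatrixMultiplication.MatrixMultiplication.Theorems.TAStatKM

open TECert (vol us)
open TAStat (Entry e0 cover)
open TAStat2M (c2W tiOK)
open ShapeCert (D)

/-! ## The extra U11-G test at a parameter `t′` -/

/-- **Extra U11-G test** at order `M` for the maximal member `l` = (gain `g`, pair-product sum `p`, volume `V`, smallest size `al`, least pair product `tl`)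
with explicit-companion aggregates `A`, at a bucket with lower end `tbj`, for the extra entry `x = (t′, gW′, wW′)`: guards `3 ≤ t′`, `V < t′·p`, `amax ≤ t′`,
an explicit source (a companion with `amin < t′ ≤ tbj`, or `l` with `al < t′ ≤ tl`); then «budget exceeded» or `c2W` at `t′` with the density `gW′/wW′`. [original] -/
def testX (g p V al tl : ℕ) (A : Agg) (tbj M : ℕ) (x : ℕ × ℕ × ℕ) : Bool :=
  Nat.ble 3 x.1 && Nat.blt V (x.1 * p) && Nat.ble A.2.2.2.2.1 x.1 &&
    ((Nat.blt A.2.2.2.1 x.1 && Nat.ble x.1 tbj) || (Nat.blt al x.1 && Nat.ble x.1 tl)) &&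
    (Nat.blt (x.1 * M + (2 * x.1 * x.1 - 1)) ((x.1 * p - V) + (x.1 * A.2.1 - A.2.2.1)) ||
      c2W g p V x.1 A.1 A.2.1 A.2.2.1 M (0, 1, x.2.1, x.2.2))

/-- **Soundness of the extra test.**  At order `M`, with `GR`, `W` the non-explicit members' total gain and U11-G weight at `t′ = x.1`: the density bound
`GR·wW′ ≤ gW′·W` and — under the test's guards — the Grynkiewicz budget `(t′·p − V) + (t′·pO − vO) + W ≤ t′·M + (2t′² − 1)` give `g + gO + GR ≤ 10⁶·M`. [original] -/
theorem testX_sound {g p V al tl : ℕ} {A : Agg} {tbj M : ℕ} {x : ℕ × ℕ × ℕ}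
    (h : testX g p V al tl A tbj M x = true)
    {GR W : ℕ} (hwW : 1 ≤ x.2.2) (hGW : GR * x.2.2 ≤ x.2.1 * W)
    (hW : 3 ≤ x.1 → V < x.1 * p → A.2.2.2.2.1 ≤ x.1 → ((A.2.2.2.1 < x.1 ∧ x.1 ≤ tbj) ∨ (al < x.1 ∧ x.1 ≤ tl)) →
      (x.1 * p - V) + (x.1 * A.2.1 - A.2.2.1) + W ≤ x.1 * M + (2 * x.1 * x.1 - 1)) :
    g + A.1 + GR ≤ D * M := by
  simp only [testX, Bool.or_eq_true, Bool.and_eq_true, Nat.ble_eq, Nat.blt_eq] at h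
  obtain ⟨⟨⟨⟨ht3, hVtp⟩, hamax⟩, hsrc⟩, hbw⟩ := h
  have hW' := hW ht3 hVtp hamax hsrc
  rcases hbw with hover | hc
  · exfalso; omega
  · simp only [c2W, Nat.ble_eq] at hc
    have h1 : x.2.1 * ((x.1 * p - V) + (x.1 * A.2.1 - A.2.2.1)) + x.2.1 * W ≤ x.2.1 * (x.1 * M + (2 * x.1 * x.1 - 1)) := by
      rw [← Nat.mul_add]; exact Nat.mul_le_mul_left _ hW'
    have key : (g + A.1 + GR) * x.2.2 ≤ D * M * x.2.2 := by
      rw [Nat.add_mul]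
      omega
    exact Nat.le_of_mul_le_mul_right key hwW

/-- the node test with extras: `testK` at the bucket parameter, or some extra entry of the bucket passes `testX` [original] -/
def testKX (g p V d al tl : ℕ) (A : Agg) (tbj t M : ℕ) (e : Entry) (root : Bool) (xs : List (ℕ × ℕ × ℕ)) : Bool :=
  testK g p V d al tl A tbj t M e root || xs.any (testX g p V al tl A tbj M)

/-! ## The tree (Bool checkers; data passed as parameters) -/

section Tree

variable (tb : ℕ → ℕ) (m2 : ℕ → List (ℕ × ℕ × ℕ)) (gain : ℕ → ℕ) (row : ℕ → Entry) (xrow : ℕ → List (ℕ × ℕ × ℕ))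

/-- **The tree** below the root (fuel `n`), node test `testKX` (extras `xrow j`); otherwise as `treeK`: case (i) over the allowed suffix (at most `kmax` explicit
members) AND case (ii) = descent to bucket `j − 1`. [original] -/
def treeKX (g p V d al tl M kmax : ℕ) : ℕ → Agg → ℕ → List (ℕ × ℕ × ℕ) → Bool
  | 0, _, _, _ => false
  | n + 1, A, j, ms =>
    testKX g p V d al tl A (tb j) (tb j) M (row j) false (xrow j) ||
      ((Nat.blt A.2.2.2.2.2 kmax && goI gain V (fun A' ms' => treeKX g p V d al tl M kmax n A' j ms') A ms) &&
        match j with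
        | 0 => false
        | j' + 1 => treeKX g p V d al tl M kmax n A j' (m2 j'))

/-- **The root** at bucket `j` (order `M`) for a maximal member whose own bucket is `j0 ≤ j` (as `rootK`, node test `testKX`). [original] -/
def rootKX (g p V d al tl M kmax j j0 : ℕ) : Bool :=
  testKX g p V d al tl agg0 (tb j) (tb j) M (row j) true (xrow j) ||
    (goI gain V (fun A' ms' => treeKX tb m2 gain row xrow g p V d al tl M kmax (kmax + j + 1) A' j ms') agg0 (m2 j) &&
      (Nat.blt j0 j ||
        match j with
        | 0 => false
        | j' + 1 => treeKX tb m2 gain row xrow g p V d al tl M kmax (kmax + j + 1) agg0 j' (m2 j')))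

/-- the tree cover of the orders `[L, H]` at bucket `j`: the root passes at every order -/
def coverKX (g p V d al tl kmax j j0 L H : ℕ) : Bool :=
  (List.range (H + 1 - L)).all fun k => rootKX tb m2 gain row xrow g p V d al tl (L + k) kmax j j0

variable (tp : ℕ → ℕ)

/-- Walk the buckets `j, j+1, …` of a table row (dropped to index `j`) for a maximal member whose own bucket is `j0`: escape once `tiOK V (TB[j])`,
else the one-member `cover` at `t = TP[j]` or the tree cover `coverKX`. [original] -/
def walk4 (g p V d al tl kmax L H j0 : ℕ) : List Entry → ℕ → Bool
  | [], _ => true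
  | e :: es, j => tiOK V (tb j) ||
      ((cover g p V d (tp j) L H e || coverKX tb m2 gain row xrow g p V d al tl kmax j j0 L H) && walk4 g p V d al tl kmax L H j0 es (j + 1))

/-- Soundness of the walk: if no bucket `j + k'`, `k' ≤ k`, escapes, then at bucket `j + k` the one-member `cover` passes at `t = TP[j+k]` or the
tree cover passes. [bookkeeping] -/
theorem walk4_sound (g p V d al tl kmax L H j0 : ℕ) : ∀ (es : List Entry) (j : ℕ),
    walk4 tb m2 gain row xrow tp g p V d al tl kmax L H j0 es j = true →
    ∀ k, k < es.length → (∀ k', k' ≤ k → tiOK V (tb (j + k')) = false) →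
      cover g p V d (tp (j + k)) L H (es.getD k e0) = true ∨
        coverKX tb m2 gain row xrow g p V d al tl kmax (j + k) j0 L H = true
  | [], j, _, k, hk, _ => by simp at hk
  | e :: es, j, h, k, hk, hsmall => by
    have hunf : walk4 tb m2 gain row xrow tp g p V d al tl kmax L H j0 (e :: es) j = (tiOK V (tb j) ||
        ((cover g p V d (tp j) L H e || coverKX tb m2 gain row xrow g p V d al tl kmax j j0 L H) &&
          walk4 tb m2 gain row xrow tp g p V d al tl kmax L H j0 es (j + 1))) := rfl
    rw [hunf, Bool.or_eq_true, Bool.and_eq_true, Bool.or_eq_true] at h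
    rcases h with hstop | ⟨hc, hrest⟩
    · have h0 := hsmall 0 (Nat.zero_le _)
      simp only [Nat.add_zero] at h0
      rw [h0] at hstop
      exact absurd hstop Bool.false_ne_true
    · cases k with
      | zero => simpa using hc
      | succ k =>
        have hk' : k < es.length := by simpa using hk
        have := walk4_sound g p V d al tl kmax L H j0 es (j + 1) hrest k hk' (fun k' hk'' => by
          have := hsmall (k' + 1) (by omega)
          simpa [Nat.add_right_comm j 1 k', Nat.add_assoc] using this)
        simpa [Nat.add_right_comm j 1 k, Nat.add_assoc] using this

/-- the tree cover at an order `M ∈ [L, H]` gives the root check at `M` [bookkeeping] -/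
theorem coverKX_at {g p V d al tl kmax j j0 L H M : ℕ} (h : coverKX tb m2 gain row xrow g p V d al tl kmax j j0 L H = true)
    (hLM : L ≤ M) (hMH : M ≤ H) : rootKX tb m2 gain row xrow g p V d al tl M kmax j j0 = true := by
  simp only [coverKX, List.all_eq_true, List.mem_range] at h
  have := h (M - L) (by omega)
  rwa [show L + (M - L) = M by omega] at this

end Tree

end Summit.MatrixMultiplication.MatrixMultiplication.Theorems.TAStatKM
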